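import Summits.ABC.IUTFork.Cor312Ind3IteratesVacuityInstancesSqrtNegOne
import HarnessLib

/-!
# [IUTchIII] Thm 3.11 (ii) (Ind3), honest model: the ODD-PRIME instances under [IUTchI] Def. 3.1 (a) "`√−1 ∈ F`"
# (abc-iut cell, wave-4 seat abc-iut-w4-d016, gen 7; record-only, D-0012; proof-only, 0 definitions)

S. Mochizuki, *Inter-universal Teichmüller theory III*, kurims manuscript (May 2020), Prop. 3.5 (ii) (a)(b)
pp. 104–105, Rmk. 1.1.1 (i) p. 28; *Inter-universal Teichmüller theory I*, Def. 3.1 (a) p. 61 "`F` is a number field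
such that `√−1 ∈ F`" (abc-iut-L5-t2 `InitialThetaData.sqrt_neg_one_mem`) [claim: Mochizuki2012, status: disputed].

Sequel of abc-iut-w5-d172's `Cor312Ind3IteratesVacuityInstances` (p437195: every case of abc-iut-w5-d017's
place-level ramification criterion realised by a number field) and `Cor312Ind3IteratesVacuityInstancesSqrtNegOne`
(p437713: the two DYADIC answers under Def. 3.1 (a)); it is that seat's published successor item (a) (HOME/HANDOFF.md
2026-08-26T10:24:10Z «instances with `√−1 ∈ F` at ODD `p` … needs the toolkit lemma with `‖xⁿ‖ = ‖p‖^j`»). The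
odd-prime instances of p437195 (`ℚ[X]/(g)`, `g ∣ X^{p+1} − p` resp. `g ∣ X^{mp} − p`) need not contain `√−1`; THIS
FILE realises BOTH odd-prime answers by number fields SATISFYING Def. 3.1 (a), with ONE generator each:

* §0 (toolkit) `Real.dvd_mul_absRamificationIdx_of_norm_pow_eq` — in the MLF class over `ℚ_p`, **`‖x‖ⁿ = p^{−j}`
  forces `n ∣ j·e`** (the value group is `p^{(1/e)ℤ}`, abc-iut-S1 `exists_norm_eq_rpow`: `‖x‖ = p^{−m/e}`, so
  `m·n = j·e`); the tree had only the inequality form `n ≤ e` (`le_absRamificationIdx_of_norm_pow_eq_inv`, p437713).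
  At a finite place: `Real.dvd_mul_ramificationIdx_of_pow_eq_neg_pow` (`xⁿ = −p^j` in `F_v` ⇒ `n ∣ j·e(v|p)`).
  Kronecker: `Real.exists_numberField_pow_eq_neg_sq_finrank_le` (`ℚ[X]/(g)`, `g ∣ Xⁿ + c²`: `θⁿ = −c²`, `[F:ℚ] ≤ n`).
* §1 EMPTY at every ODD `p`: `F = ℚ[X]/(g)`, `g ∣ X^{2(p+1)} + p²`, so `θ^{2(p+1)} = −p²` and `√−1 = θ^{p+1}/p ∈ F`; at
  ANY `v ∣ p`: `2(p+1) ∣ 2·e(v|p)`, i.e. `(p+1) ∣ e(v|p) ≤ [F:ℚ] ≤ 2(p+1)`, whence `p ∤ e(v|p)` and `e(v|p) > p − 1`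
  (beyond the tame threshold of p414009), and every honest depth-`≥ 2` (Ind3) iterate image for the analytic
  logarithms is EMPTY (abc-iut-w5-d017 `Real.nonarchIterImage_add_two_eq_empty_of_not_dvd`):
  `Real.exists_numberField_sqrt_neg_one_odd_nonarchIterImage_eq_empty`.
* §2 INHABITED at every ODD `p`: `F = ℚ[X]/(g)`, `g ∣ X^{2p} + p²` (`√−1 = θ^p/p`); at any `v ∣ p`: `p ∣ e(v|p) ≤ 2p`,
  and the honest depth-`2` image is NONEMPTY (abc-iut-w5-d017 `Real.nonarchIterImage_analyticLogv_two_nonempty_of_dvd`):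
  `Real.exists_numberField_sqrt_neg_one_odd_nonarchIterImage_two_nonempty`.

CENSUS SENTENCE (numbers, not a side): together with p437713, among number fields satisfying Def. 3.1 (a) BOTH answers
of the honest-model (Ind3) depth-`≥ 2` clause occur at EVERY rational prime `p` — Def. 3.1 (a) alone decides none of
them (at odd `p` this is as expected: `ℚ_p(√−1)/ℚ_p` is unramified, so `√−1` constrains `e(v|p)` only at `p = 2`).

HONEST FRAMING: classical algebraic number theory about the cell's MODEL of the (Ind3) iterates; nothing here asserts
or denies [IUTchIII] Cor. 3.12 or takes a side; census ≠ verdict; typed ≠ proved. No definition, no Prop-valued fact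
(D-0067 (1)). [cite: NeukirchANT1999, Ch. II (5.5), Prop. (6.8)] [cite: Lang2002, Ch. V §2 Prop. 2.3]
-/

noncomputable section

open Set Polynomial

namespace Summit.ABC.IUTFork.Thm311.Real

open NumberField IsDedekindDomain Literature.IUT.LogVolume Literature.IUT.LogThetaLattice
  Literature.NumberTheory.NumberFields

variable {F : Type} [Field F] [NumberField F]

/-! ## §0. Toolkit: `‖x‖ⁿ = p^{−j}` forces `n ∣ j·e`; Kronecker fields with `θⁿ = −c²` -/

/-- In a field of the MLF class over `ℚ_p`: **`‖x‖ⁿ = p^{−j}` forces `n ∣ j·e`** — the value group of `K^×` is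
`p^{(1/e)ℤ}` (`‖x‖ = p^{−m/e}`, abc-iut-S1 `exists_norm_eq_rpow`), so `m·n = j·e`. The inequality form `n ≤ e`
(`j = 1`) is abc-iut-w5-d172's `le_absRamificationIdx_of_norm_pow_eq_inv`. [cite: NeukirchANT1999, Ch. II (5.5)] -/
theorem dvd_mul_absRamificationIdx_of_norm_pow_eq (p : ℕ) [Fact p.Prime] {K : Type*} [NontriviallyNormedField K]
    [NormedAlgebra ℚ_[p] K] [IsUltrametricDist K] [ProperSpace K] {n j : ℕ} (x : K)
    (hx : ‖x‖ ^ n = ((p : ℝ) ^ j)⁻¹) : n ∣ j * absRamificationIdx p K := by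
  have hp1 : (1 : ℝ) < p := by exact_mod_cast (Fact.out : p.Prime).one_lt
  have hp0 : (0 : ℝ) < p := by positivity
  rcases Nat.eq_zero_or_pos n with rfl | hn
  · -- `n = 0`: then `p^j = 1`, so `j = 0`
    have hj0 : j = 0 := by
      by_contra h
      have h1 : (1 : ℝ) < (p : ℝ) ^ j := one_lt_pow₀ hp1 h
      have h2 : ((p : ℝ) ^ j)⁻¹ < 1 := inv_lt_one_of_one_lt₀ h1
      rw [pow_zero] at hx
      linarith
    simp [hj0]
  · have hx0 : x ≠ 0 := by
      rintro rfl
      rw [norm_zero, zero_pow hn.ne'] at hx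
      exact (inv_pos.mpr (pow_pos hp0 j)).ne hx
    obtain ⟨m, hm⟩ := exists_norm_eq_rpow p K hx0
    have he0 : (0 : ℝ) < (absRamificationIdx p K : ℝ) := by exact_mod_cast absRamificationIdx_pos p K
    -- `p^{−(m/e)·n} = p^{−j}`, so `m·n = j·e`
    have h1 : (p : ℝ) ^ (-(m / (absRamificationIdx p K : ℝ)) * n) = (p : ℝ) ^ (-(j : ℝ)) := by
      rw [Real.rpow_mul hp0.le, Real.rpow_natCast, ← hm, hx, Real.rpow_neg hp0.le, Real.rpow_natCast]
    have h2 : -(m / (absRamificationIdx p K : ℝ)) * n = -(j : ℝ) :=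
      le_antisymm ((Real.rpow_le_rpow_left_iff hp1).mp h1.le) ((Real.rpow_le_rpow_left_iff hp1).mp h1.ge)
    have h3 : (m : ℝ) * n = j * (absRamificationIdx p K : ℝ) := by
      have h2' : (m : ℝ) / (absRamificationIdx p K : ℝ) * n = j := by linarith
      rw [div_mul_eq_mul_div, div_eq_iff he0.ne'] at h2'
      exact h2'
    have h4 : m * (n : ℤ) = ((j * absRamificationIdx p K : ℕ) : ℤ) := by exact_mod_cast h3
    have hm0 : 0 ≤ m := by
      by_contra hneg
      have h5 : m * (n : ℤ) < 0 := mul_neg_of_neg_of_pos (not_le.mp hneg) (by exact_mod_cast hn)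
      have h6 : (0 : ℤ) ≤ ((j * absRamificationIdx p K : ℕ) : ℤ) := Int.natCast_nonneg _
      linarith
    refine ⟨m.toNat, ?_⟩
    have h7 : ((j * absRamificationIdx p K : ℕ) : ℤ) = ((n * m.toNat : ℕ) : ℤ) := by
      rw [← h4, Nat.cast_mul, Int.toNat_of_nonneg hm0, mul_comm]
    exact_mod_cast h7

/-- **`xⁿ = −p^j` in `F_v` with `p ∈ 𝔭_v` ⇒ `n ∣ j·e(v|p)`** (`‖−p^j‖ = p^{−j}` in the rescaled completion;
abc-iut-S7's `e(F_v) = e(v|p)`). [cite: NeukirchANT1999, Ch. II Prop. (6.8)] -/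
theorem dvd_mul_ramificationIdx_of_pow_eq_neg_pow (v : HeightOneSpectrum (𝓞 F)) {p : ℕ} (hp : p.Prime)
    (hv : ((p : ℕ) : 𝓞 F) ∈ v.asIdeal) {n j : ℕ} (x : v.adicCompletion F)
    (hx : x ^ n = -((p : v.adicCompletion F) ^ j)) : n ∣ j * v.asIdeal.ramificationIdx ℤ := by
  haveI : Fact p.Prime := ⟨hp⟩
  have hyn : (RescaledCompletion.of F p v hv x) ^ n = -((p : RescaledCompletion F p v hv) ^ j) := by
    rw [← map_pow, hx, map_neg, map_pow, map_natCast]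
  have hnorm : ‖RescaledCompletion.of F p v hv x‖ ^ n = ((p : ℝ) ^ j)⁻¹ := by
    rw [← norm_pow, hyn, norm_neg, norm_pow, norm_prime p (RescaledCompletion F p v hv), inv_pow]
  have h := dvd_mul_absRamificationIdx_of_norm_pow_eq p (RescaledCompletion.of F p v hv x) hnorm
  rwa [absRamificationIdx_rescaledCompletion] at h

/-- **`xⁿ = p^j` in `F_v` with `p ∈ 𝔭_v` ⇒ `n ∣ j·e(v|p)`** (the same with `‖p^j‖ = p^{−j}`; `j = 1` sharpens
abc-iut-w5-d172's `le_ramificationIdx_of_pow_eq_prime` from `n ≤ e` to `n ∣ e`).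
[cite: NeukirchANT1999, Ch. II Prop. (6.8)] -/
theorem dvd_mul_ramificationIdx_of_pow_eq_pow (v : HeightOneSpectrum (𝓞 F)) {p : ℕ} (hp : p.Prime)
    (hv : ((p : ℕ) : 𝓞 F) ∈ v.asIdeal) {n j : ℕ} (x : v.adicCompletion F)
    (hx : x ^ n = (p : v.adicCompletion F) ^ j) : n ∣ j * v.asIdeal.ramificationIdx ℤ := by
  haveI : Fact p.Prime := ⟨hp⟩
  have hyn : (RescaledCompletion.of F p v hv x) ^ n = (p : RescaledCompletion F p v hv) ^ j := by
    rw [← map_pow, hx, map_pow, map_natCast]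
  have hnorm : ‖RescaledCompletion.of F p v hv x‖ ^ n = ((p : ℝ) ^ j)⁻¹ := by
    rw [← norm_pow, hyn, norm_pow, norm_prime p (RescaledCompletion F p v hv), inv_pow]
  have h := dvd_mul_absRamificationIdx_of_norm_pow_eq p (RescaledCompletion.of F p v hv x) hnorm
  rwa [absRamificationIdx_rescaledCompletion] at h

/-- **A number field with `θⁿ = −c²`** (`n ≥ 1`, `c ∈ ℕ`): `ℚ[X]/(g)`, `g ∣ Xⁿ + c²` irreducible, of degree `≤ n`
(abc-iut-w5-d172's Kronecker lemma `exists_numberField_aeval_eq_zero_finrank_le`). [cite: Lang2002, Ch. V §2 Prop. 2.3] -/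
theorem exists_numberField_pow_eq_neg_sq_finrank_le {n : ℕ} (hn : n ≠ 0) (c : ℕ) :
    ∃ (F : Type) (_ : Field F) (_ : NumberField F) (θ : F), θ ^ n = -((c : F) ^ 2) ∧ Module.finrank ℚ F ≤ n := by
  let f : ℚ[X] := X ^ n + C ((c : ℚ) ^ 2)
  have hf : f.natDegree = n := natDegree_X_pow_add_C
  obtain ⟨F, _, _, θ, hθ, hdeg⟩ := exists_numberField_aeval_eq_zero_finrank_le f (by rw [hf]; exact hn)
  refine ⟨F, inferInstance, inferInstance, θ, ?_, by rwa [hf] at hdeg⟩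
  have h1 : aeval θ f = θ ^ n + (c : F) ^ 2 := by simp [f, map_natCast]
  rw [h1] at hθ
  linear_combination hθ

/-! ## §1. `√−1 ∈ F = ℚ(θ)`, `θ^{2(p+1)} = −p²`, `p` odd: `(p+1) ∣ e(v|p)`, `p ∤ e`, EMPTY depth `≥ 2` -/

/-- **EXISTENCE AT EVERY ODD PRIME UNDER Def. 3.1 (a), EMPTY SIDE**: for every odd prime `p` there are a number
field `F ∋ √−1` (`= ℚ[X]/(g)`, `g ∣ X^{2(p+1)} + p²`; `√−1 = θ^{p+1}/p`) and a finite place `v` with `p_v = p`,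
`(p + 1) ∣ e(v|p) ≤ 2(p + 1)` — so `p ∤ e(v|p)` and the tame hypothesis `e(v|p_v) ≤ p_v − 1` of p414009 FAILS — at
which every honest depth-`≥ 2` (Ind3) iterate image for the analytic logarithms is EMPTY (abc-iut-w5-d017's criterion
`Real.nonarchIterImage_add_two_eq_empty_of_not_dvd`). [claim: Mochizuki2012, status: disputed] -/
theorem exists_numberField_sqrt_neg_one_odd_nonarchIterImage_eq_empty {p : ℕ} (hp : p.Prime) (hp2 : p ≠ 2) :
    ∃ (F : Type) (_ : Field F) (_ : NumberField F) (v : HeightOneSpectrum (𝓞 F)),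
      (∃ i : F, i ^ 2 = -1) ∧ residueChar F v = p ∧ (p + 1) ∣ v.asIdeal.ramificationIdx ℤ ∧
        v.asIdeal.ramificationIdx ℤ ≤ 2 * (p + 1) ∧ ¬ residueChar F v ∣ v.asIdeal.ramificationIdx ℤ ∧
          ¬ v.asIdeal.ramificationIdx ℤ ≤ residueChar F v - 1 ∧
            ∀ k : ℕ, nonarchIterImage (analyticLogv F) v (k + 2) = ∅ := by
  obtain ⟨F, _, _, θ, hθ, hdeg⟩ := exists_numberField_pow_eq_neg_sq_finrank_le (n := 2 * (p + 1)) (by omega) p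
  have hp0 : (p : F) ≠ 0 := by exact_mod_cast hp.ne_zero
  -- `√−1 = θ^{p+1}/p`
  have hi : (θ ^ (p + 1) / p) ^ 2 = -1 := by
    rw [div_pow, ← pow_mul, show (p + 1) * 2 = 2 * (p + 1) by ring, hθ, neg_div, div_self (pow_ne_zero 2 hp0)]
  obtain ⟨v, hv⟩ := exists_heightOneSpectrum_natCast_mem' (F := F) hp
  have hx : (algebraMap F (v.adicCompletion F) θ) ^ (2 * (p + 1)) = -((p : v.adicCompletion F) ^ 2) := by
    rw [← map_pow, hθ, map_neg, map_pow, map_natCast]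
  -- `2(p+1) ∣ 2e`, i.e. `(p+1) ∣ e`
  have hdvd2 : 2 * (p + 1) ∣ 2 * v.asIdeal.ramificationIdx ℤ :=
    dvd_mul_ramificationIdx_of_pow_eq_neg_pow v hp hv _ hx
  have hdvd : (p + 1) ∣ v.asIdeal.ramificationIdx ℤ := Nat.dvd_of_mul_dvd_mul_left (by norm_num) hdvd2
  haveI := v.isPrime
  have hfpos : 0 < v.asIdeal.inertiaDeg ℤ := Ideal.inertiaDeg_pos (R := ℤ) (q := v.asIdeal)
  have hepos : 0 < v.asIdeal.ramificationIdx ℤ := Ideal.ramificationIdx_pos v.asIdeal ℤ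
  have hef : v.asIdeal.ramificationIdx ℤ * v.asIdeal.inertiaDeg ℤ ≤ 2 * (p + 1) :=
    (ramificationIdx_mul_inertiaDeg_le_finrank' v).trans hdeg
  have hele : v.asIdeal.ramificationIdx ℤ ≤ 2 * (p + 1) :=
    le_trans (Nat.le_mul_of_pos_right _ hfpos) hef
  have hres : residueChar F v = p := residueChar_eq_of_prime_natCast_mem v hp hv
  -- `e = (p+1)·k` with `1 ≤ k ≤ 2`, so `p ∣ e` would force `p ∣ k`, impossible for `p ≥ 3`
  have hndvd : ¬ p ∣ v.asIdeal.ramificationIdx ℤ := by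
    obtain ⟨k, hk⟩ := hdvd
    intro h
    rw [hk] at h hepos hele
    have hcop : Nat.Coprime p (p + 1) := Nat.coprime_self_add_right.mpr (Nat.coprime_one_right p)
    have hpk : p ∣ k := hcop.dvd_of_dvd_mul_left h
    have hk0 : 0 < k := Nat.pos_of_ne_zero fun h0 => by
      rw [h0, mul_zero] at hepos
      exact lt_irrefl 0 hepos
    have hkle : k ≤ 2 := by
      by_contra hk3
      have : (p + 1) * 3 ≤ (p + 1) * k := Nat.mul_le_mul_left _ (not_le.mp hk3)
      omega
    have hple : p ≤ k := Nat.le_of_dvd hk0 hpk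
    have h3 : 3 ≤ p := by
      rcases hp.eq_two_or_odd' with h | h
      · exact absurd h hp2
      · have := hp.two_le
        rcases h with ⟨r, hr⟩
        omega
    omega
  refine ⟨F, inferInstance, inferInstance, v, ⟨θ ^ (p + 1) / p, hi⟩, hres, hdvd, hele, by rwa [hres], ?_,
    fun k => nonarchIterImage_add_two_eq_empty_of_not_dvd v (by rwa [hres]) k⟩
  obtain ⟨k, hk⟩ := hdvd
  rw [hres, hk]
  rw [hk] at hepos
  have hk0 : 0 < k := by
    rcases Nat.eq_zero_or_pos k with h | h
    · rw [h, mul_zero] at hepos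
      exact absurd hepos (lt_irrefl 0)
    · exact h
  have : (p + 1) * 1 ≤ (p + 1) * k := Nat.mul_le_mul_left _ hk0
  omega

/-! ## §2. `√−1 ∈ F = ℚ(θ)`, `θ^{2p} = −p²`, `p` odd: `p ∣ e(v|p)`, INHABITED depth `2` -/

/-- **EXISTENCE AT EVERY ODD PRIME UNDER Def. 3.1 (a), INHABITED SIDE**: for every odd prime `p` there are a number
field `F ∋ √−1` (`= ℚ[X]/(g)`, `g ∣ X^{2p} + p²`; `√−1 = θ^p/p`) and a finite place `v` with `p_v = p`,
`p ∣ e(v|p) ≤ 2p` — so the tame hypothesis of p414009 fails — at which the honest depth-`2` (Ind3) iterate image for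
the analytic logarithms is NONEMPTY (abc-iut-w5-d017's `Real.nonarchIterImage_analyticLogv_two_nonempty_of_dvd`).
Together with §1 and p437713: Def. 3.1 (a) decides the honest-model (Ind3) clauses at NO prime.
[claim: Mochizuki2012, status: disputed] -/
theorem exists_numberField_sqrt_neg_one_odd_nonarchIterImage_two_nonempty {p : ℕ} (hp : p.Prime) (hp2 : p ≠ 2) :
    ∃ (F : Type) (_ : Field F) (_ : NumberField F) (v : HeightOneSpectrum (𝓞 F)),
      (∃ i : F, i ^ 2 = -1) ∧ residueChar F v = p ∧ residueChar F v ∣ v.asIdeal.ramificationIdx ℤ ∧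
        v.asIdeal.ramificationIdx ℤ ≤ 2 * p ∧ ¬ v.asIdeal.ramificationIdx ℤ ≤ residueChar F v - 1 ∧
          (nonarchIterImage (analyticLogv F) v 2).Nonempty := by
  obtain ⟨F, _, _, θ, hθ, hdeg⟩ := exists_numberField_pow_eq_neg_sq_finrank_le (n := 2 * p)
    (by have := hp.pos; omega) p
  have hp0 : (p : F) ≠ 0 := by exact_mod_cast hp.ne_zero
  -- `√−1 = θ^p/p`
  have hi : (θ ^ p / p) ^ 2 = -1 := by
    rw [div_pow, ← pow_mul, show p * 2 = 2 * p by ring, hθ, neg_div, div_self (pow_ne_zero 2 hp0)]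
  obtain ⟨v, hv⟩ := exists_heightOneSpectrum_natCast_mem' (F := F) hp
  have hx : (algebraMap F (v.adicCompletion F) θ) ^ (2 * p) = -((p : v.adicCompletion F) ^ 2) := by
    rw [← map_pow, hθ, map_neg, map_pow, map_natCast]
  -- `2p ∣ 2e`, i.e. `p ∣ e`
  have hdvd2 : 2 * p ∣ 2 * v.asIdeal.ramificationIdx ℤ := dvd_mul_ramificationIdx_of_pow_eq_neg_pow v hp hv _ hx
  have hdvd : p ∣ v.asIdeal.ramificationIdx ℤ := Nat.dvd_of_mul_dvd_mul_left (by norm_num) hdvd2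
  haveI := v.isPrime
  have hfpos : 0 < v.asIdeal.inertiaDeg ℤ := Ideal.inertiaDeg_pos (R := ℤ) (q := v.asIdeal)
  have hepos : 0 < v.asIdeal.ramificationIdx ℤ := Ideal.ramificationIdx_pos v.asIdeal ℤ
  have hef : v.asIdeal.ramificationIdx ℤ * v.asIdeal.inertiaDeg ℤ ≤ 2 * p :=
    (ramificationIdx_mul_inertiaDeg_le_finrank' v).trans hdeg
  have hele : v.asIdeal.ramificationIdx ℤ ≤ 2 * p := le_trans (Nat.le_mul_of_pos_right _ hfpos) hef
  have hres : residueChar F v = p := residueChar_eq_of_prime_natCast_mem v hp hv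
  have hple : p ≤ v.asIdeal.ramificationIdx ℤ := Nat.le_of_dvd hepos hdvd
  refine ⟨F, inferInstance, inferInstance, v, ⟨θ ^ p / p, hi⟩, hres, by rwa [hres], hele, ?_,
    nonarchIterImage_analyticLogv_two_nonempty_of_dvd v (by rwa [hres]) (by rwa [hres])⟩
  rw [hres]
  have := hp.two_le
  omega

end Summit.ABC.IUTFork.Thm311.Real

end
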